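import Summits.AtomisticToContinuum.HydrodynamicLimit.Theorems.OneFlightGossipEngineClampedCurrentsDockEntropyStep
import Summits.AtomisticToContinuum.HydrodynamicLimit.Theorems.SpeedCapSurgeryCappedEulerLimitStubKlDivNeTop
import HarnessLib

/-!
# Route `SpeedCapSurgery`, crux `CappedEulerLimit` (stmt-AtomisticToContinuum-17739), V: the window entropy step for RESTRICTED initial laws

Line `registered`, lead cycle 3 (continuation seat prover-line-stmt-AtomisticToContinuum-17739-c1-0). The residue of the line
(`stub_cappedWindowStepMeso`) is Nachtergaele–Yau's one-window entropy step ON THE CAP EVENT; its first ingredient — Yau's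
entropy inequality for one window, run for the law of the system started from the RESTRICTED local Gibbs law `λ_N|_S` (a
sub-probability law) — is proved here, as the capped twin of the dock's `ClampedCurrentsDockEntropyStep.stub_windowEntropyStep`
(crux 14680, ES):

* §1 `integral_le_inv_mul_toReal_klDiv_add_mass_mul` — the entropy inequality with a tilt for a FINITE (sub-probability)
  law `μ` against a probability reference `ν`: `KL(μ‖ν) < ∞`, `Y ∈ L¹(μ)`, `∫⁻ e^{γY} dν ≤ e^B` ⟹
  `E_μ Y ≤ γ⁻¹ (KL(μ‖ν) + μ(univ)·B)` (normalise `μ`, apply the probability version, and use `m − 1 − m log m ≤ 0`; Mathlib's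
  `klDiv` of a sub-probability law carries the mass correction `+ ν(univ) − μ(univ)`, which is exactly what absorbs the
  normalisation cost).
* §2 `restricted_windowEntropyStep` — for ANY set `S` of initial data: under `λ_N` restricted to `S`, the window functional
  `Y(z) = Σ_i w⁻¹∫_s^{s+w} F(Φ_r z)_i dr + Yc(Φ_s z)` is integrable and
  `∫_S Y dλ_N ≤ γ⁻¹ (KL((Φ_s)_*(λ_N|_S) ‖ ψ_N) + λ_N(S)·B)` as soon as `∫⁻ exp(γ Y₀) dψ_N ≤ e^B`
  (flow property on the good set, measurable version of `Y₀`, transport, integrability by energy conservation, finiteness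
  `stub_cappedKlDivNeTop`, and §1). With `S` the cap event this is the step in which the capped relative entropy `H_cap(s)` prices
  the window currents.
* §3 `sum_windowAverage_congr_of_speed_le`, `capped_windowEntropyStep_trunc` — EXACT TRUNCATION ON THE CAP EVENT: if `S` is a
  (null-measurable) set of initial data whose trajectories keep all speeds `≤ Mc` on `[0,t]` and `FM` is any continuous
  truncation of `F` agreeing with it on `{‖v‖ ≤ Mc}`, the untruncated window functional under `λ_N|_S` is priced by
  `γ⁻¹ (KL((Φ_s)_*(λ_N|_S) ‖ ψ_N) + λ_N(S)·B)` with `B` the exponential moment of the TRUNCATED functional under the REFERENCE law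
  (no Chebyshev term; the cap level enters only through `B`).

References: H.-T. Yau, Lett. Math. Phys. 22 (1991) §2; C. Kipnis, C. Landim, *Scaling Limits of Interacting Particle Systems*
(1999), App. 1 §8; B. Nachtergaele, H.-T. Yau, Comm. Math. Phys. 243 (2003) §5. (`--supports stmt-AtomisticToContinuum-17739`.)
-/

noncomputable section

namespace Summit.AtomisticToContinuum.HydrodynamicLimit.Theorems.CappedEulerLimit

open scoped BigOperators ENNReal NNReal Topology Classical Interval
open MeasureTheory Filter Set InformationTheory
open Literature.MathematicalPhysics.KineticTheory Literature.Analysis.FluidPDE Literature.Analysis.FunctionSpaces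
open Summit.AtomisticToContinuum.HydrodynamicLimit.Theorems
open Summit.AtomisticToContinuum.HydrodynamicLimit.Theorems.EntropyClockDock (ae_mem_good_localGibbsLaw
  integrable_sum_norm_sq_flow integral_le_inv_mul_toReal_klDiv_add)
open Summit.AtomisticToContinuum.HydrodynamicLimit.Theorems.ClampedCurrentsDockEntropyStep
  (nonneg_of_abs_le_mul_one_add_sq measurable_intervalIntegral_comp_flow_apply abs_sum_windowAverage_le
  intervalIntegral_shift_flow stub_windowEntropyStep)

/-! ## §1 The entropy inequality with a tilt for a sub-probability law -/

section EntropyInequality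

variable {α : Type*} [MeasurableSpace α] {μ ν : Measure α} [IsFiniteMeasure μ] [IsProbabilityMeasure ν]

/-- **Entropy inequality with a tilt `γ > 0` for a FINITE law against a probability reference.** For a finite measure
`μ` (mass `m = μ(univ)`, e.g. the push-forward of a restricted probability law, `m ≤ 1`) and a probability measure `ν`
with `KL(μ‖ν) < ∞`, a measurable `Y ∈ L¹(μ)` and `∫⁻ e^{γY} dν ≤ e^B`:
`E_μ Y ≤ γ⁻¹ (KL(μ‖ν) + m·B)`. Proof: for `μ = 0` both sides are trivial (`KL(0‖ν) = 1`); otherwise normalise,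
`μ̄ = m⁻¹ μ`, apply the probability version `EntropyClockDock.integral_le_inv_mul_toReal_klDiv_add` to `μ̄`, and use
`m·KL(μ̄‖ν) = KL(μ‖ν) − 1 + m − m log m ≤ KL(μ‖ν)` (`toReal_klDiv_smul_left`; `m log m ≥ m − 1`). Mathlib's `klDiv`
for unequal masses is `∫ log(dμ/dν) dμ + ν(univ) − μ(univ)`. [cite: KipnisLandim1999, Appendix 1 §8] -/
theorem integral_le_inv_mul_toReal_klDiv_add_mass_mul (hfin : klDiv μ ν ≠ ∞) {Y : α → ℝ} (hYm : Measurable Y)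
    (hY : Integrable Y μ) {γ : ℝ} (hγ : 0 < γ) {B : ℝ}
    (hB : ∫⁻ x, ENNReal.ofReal (Real.exp (γ * Y x)) ∂ν ≤ ENNReal.ofReal (Real.exp B)) :
    ∫ x, Y x ∂μ ≤ γ⁻¹ * ((klDiv μ ν).toReal + (μ univ).toReal * B) := by
  rcases eq_zero_or_neZero μ with rfl | hμ
  · simp only [integral_zero_measure, Measure.coe_zero, Pi.zero_apply, ENNReal.toReal_zero, zero_mul,
      add_zero]
    exact mul_nonneg (inv_nonneg.2 hγ.le) ENNReal.toReal_nonneg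
  -- normalisation `μ̄ = c⁻¹ • μ`, `c = μ(univ)`
  obtain ⟨hμν, h_int⟩ := klDiv_ne_top_iff.1 hfin
  set c : ℝ≥0 := (μ univ).toNNReal with hc_def
  have hc0 : c ≠ 0 := by
    rw [hc_def]
    exact ENNReal.toNNReal_ne_zero.2 ⟨NeZero.ne _, measure_ne_top μ univ⟩
  have hcc : (c : ℝ≥0∞) = μ univ := by rw [hc_def, ENNReal.coe_toNNReal (measure_ne_top μ univ)]
  have hcreal : (c : ℝ) = (μ univ).toReal := by rw [hc_def]; rfl
  have hcpos : 0 < (c : ℝ) := NNReal.coe_pos.2 (pos_iff_ne_zero.2 hc0)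
  set μ' : Measure α := c⁻¹ • μ with hμ'_def
  haveI : IsProbabilityMeasure μ' := by
    constructor
    rw [hμ'_def, Measure.coe_nnreal_smul_apply, ← ENNReal.coe_toNNReal (measure_ne_top μ univ), ← hc_def,
      ← ENNReal.coe_mul, inv_mul_cancel₀ hc0, ENNReal.coe_one]
  -- finiteness of `KL(μ̄‖ν)` and integrability under `μ̄`
  have h_int' : Integrable (llr μ' ν) μ' := by
    refine Integrable.smul_measure_nnreal ?_
    rw [integrable_congr (llr_smul_nnreal_left hμν c⁻¹ (by simpa))]
    fun_prop
  have hfin' : klDiv μ' ν ≠ ∞ := klDiv_ne_top (hμν.smul_left _) h_int'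
  have hY' : Integrable Y μ' := hY.smul_measure_nnreal
  -- the probability version for `μ̄`
  have hEI := integral_le_inv_mul_toReal_klDiv_add (μ := μ') (ν := ν) hfin' hYm hY' hγ hB
  -- `KL(μ̄‖ν) = c⁻¹ KL(μ‖ν) + 1 − c⁻¹ − log c` and `∫ Y dμ̄ = c⁻¹ ∫ Y dμ`
  have hKL : (klDiv μ' ν).toReal =
      (c : ℝ)⁻¹ * (klDiv μ ν).toReal + (1 - (c : ℝ)⁻¹) - Real.log c := by
    rw [hμ'_def, toReal_klDiv_smul_left hμν h_int c⁻¹]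
    simp only [NNReal.coe_inv, probReal_univ, mul_one, Real.log_inv]
    rw [measureReal_def, ← hcreal]
    field_simp
    ring
  have hI : ∫ x, Y x ∂μ' = (c : ℝ)⁻¹ * ∫ x, Y x ∂μ := by
    rw [hμ'_def, integral_smul_nnreal_measure]
    rfl
  rw [hKL, hI] at hEI
  -- `c log c ≥ c − 1`
  have hlog : (c : ℝ) - 1 - (c : ℝ) * Real.log c ≤ 0 := by
    have h := Real.one_sub_inv_le_log_of_pos hcpos
    have : (c : ℝ) * (1 - (c : ℝ)⁻¹) ≤ (c : ℝ) * Real.log c := mul_le_mul_of_nonneg_left h hcpos.le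
    rw [mul_sub, mul_one, mul_inv_cancel₀ hcpos.ne'] at this
    linarith
  -- multiply the normalised inequality by `c`
  have hmul := mul_le_mul_of_nonneg_left hEI hcpos.le
  rw [← mul_assoc, mul_inv_cancel₀ hcpos.ne', one_mul] at hmul
  rw [← hcreal]
  calc ∫ x, Y x ∂μ ≤ (c : ℝ) * (γ⁻¹ * ((c : ℝ)⁻¹ * (klDiv μ ν).toReal + (1 - (c : ℝ)⁻¹) - Real.log c + B)) := hmul
    _ = γ⁻¹ * ((klDiv μ ν).toReal + (c : ℝ) * B + ((c : ℝ) - 1 - (c : ℝ) * Real.log c)) := by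
        field_simp
        ring
    _ ≤ γ⁻¹ * ((klDiv μ ν).toReal + (c : ℝ) * B) := by
        refine mul_le_mul_of_nonneg_left ?_ (inv_nonneg.2 hγ.le)
        linarith

end EntropyInequality

/-! ## §2 The window entropy step for the law started from a RESTRICTED local Gibbs law -/

/-- **The one-window entropy step for RESTRICTED initial laws** (capped twin of
`ClampedCurrentsDockEntropyStep.stub_windowEntropyStep`). Hard spheres on `𝕋³` at reduced diameter `0 < σ < 1/2`, true law
`λ_N = localGibbsLaw σ a₀ u₀ θ₀ N Φ` (continuous positive profiles), reference `ψ_N = localGibbsLaw σ b wv ϑ N Φ`, a window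
functional `Y(z) = Σ_i w⁻¹∫_s^{s+w} F(Φ_r z)_i dr + Yc(Φ_s z)` (continuous `F` of quadratic velocity growth, collision part `Yc`
bounded on the good set and agreeing there with a measurable `Ym`) with `∫⁻ exp(γ Y₀) dψ_N ≤ e^B`,
`Y₀(z) = Σ_i w⁻¹∫₀^w F(Φ_r z)_i dr + Yc z`. Then for ANY set `S` of initial data, `Y` is `λ_N|_S`-integrable and
`∫_S Y dλ_N ≤ γ⁻¹ (KL((Φ_s)_*(λ_N|_S) ‖ ψ_N) + λ_N(S)·B)`.
Proof: integrability under `λ_N` is the dock's ES, restricted; `Y = Ỹ₀ ∘ Φ_s` `λ_N`-a.e. for a measurable version `Ỹ₀`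
(`Measurable.dite` on the good set, joint measurability of the flow), transport to the push-forward of the restricted law,
integrability there by domination (`(Φ_s)_*(λ_N|_S) ≤ (Φ_s)_*λ_N`, energy conservation), finiteness of the divergence
(`stub_cappedKlDivNeTop`) and the sub-probability entropy inequality (§1); the mass of the push-forward is `λ_N(S)`.
[cite: Yau1991, §2] [cite: NachtergaeleYau2003, §5] -/
theorem restricted_windowEntropyStep (σ : ℝ) (N : ℕ)
    (Φ : HardSphereFlow (Torus.geometry (Fin 3)) (hsDiameter σ N) (N + 1))
    (a₀ θ₀ : T3 → ℝ) (u₀ : T3 → V3) (b ϑ : T3 → ℝ) (wv : T3 → V3)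
    (F : T3 × V3 → ℝ) (Yc Ym : Config (N + 1) (Fin 3) T3 → ℝ) (C M γ B s w : ℝ)
    (S : Set (Config (N + 1) (Fin 3) T3))
    (hσ : 0 < σ) (hσ2 : σ < 1 / 2) (ha : Continuous a₀) (hθ : Continuous θ₀) (hu : Continuous u₀)
    (ha0 : ∀ x, 0 < a₀ x) (hθ0 : ∀ x, 0 < θ₀ x)
    (hb : Continuous b) (hϑ : Continuous ϑ) (hwv : Continuous wv) (hb0 : ∀ x, 0 < b x) (hϑ0 : ∀ x, 0 < ϑ x)
    (hF : Continuous F) (hFC : ∀ y, |F y| ≤ C * (1 + ‖y.2‖ ^ 2)) (hYm : Measurable Ym)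
    (hYmc : Set.EqOn Ym Yc Φ.good) (hYcM : ∀ z ∈ Φ.good, |Yc z| ≤ M) (hs : 0 ≤ s) (hw : 0 < w) (hγ : 0 < γ)
    (hB : ∫⁻ z, ENNReal.ofReal (Real.exp (γ * ((∑ i : Fin (N + 1), w⁻¹ * ∫ r in (0 : ℝ)..w, F (Φ.flow r z i)) + Yc z)))
        ∂(localGibbsLaw σ b wv ϑ N Φ) ≤ ENNReal.ofReal (Real.exp B)) :
    Integrable (fun z => (∑ i : Fin (N + 1), w⁻¹ * ∫ r in s..(s + w), F (Φ.flow r z i)) + Yc (Φ.flow s z))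
        ((localGibbsLaw σ a₀ u₀ θ₀ N Φ).restrict S) ∧
      ∫ z in S, ((∑ i : Fin (N + 1), w⁻¹ * ∫ r in s..(s + w), F (Φ.flow r z i)) + Yc (Φ.flow s z))
          ∂(localGibbsLaw σ a₀ u₀ θ₀ N Φ) ≤
        γ⁻¹ * ((klDiv (Φ.lawAt ((localGibbsLaw σ a₀ u₀ θ₀ N Φ).restrict S) s) (localGibbsLaw σ b wv ϑ N Φ)).toReal +
          (localGibbsLaw σ a₀ u₀ θ₀ N Φ S).toReal * B) := by
  set lam := localGibbsLaw σ a₀ u₀ θ₀ N Φ with hlam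
  set psi := localGibbsLaw σ b wv ϑ N Φ with hpsi
  have hσ2' : σ ≤ 1 / 2 := hσ2.le
  haveI : IsProbabilityMeasure lam := isProbabilityMeasure_localGibbsLaw ha hθ hu ha0 hθ0 hσ2' N Φ
  haveI : IsProbabilityMeasure psi := isProbabilityMeasure_localGibbsLaw hb hϑ hwv hb0 hϑ0 hσ2' N Φ
  -- the restricted law and its push-forward (finite, dominated)
  set lamS := lam.restrict S with hlamS
  haveI : IsFiniteMeasure lamS := by rw [hlamS]; infer_instance
  haveI : IsFiniteMeasure (Φ.lawAt lamS s) := by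
    rw [HardSphereFlow.lawAt_eq]; infer_instance
  have hmaple : Φ.lawAt lamS s ≤ Φ.lawAt lam s := by
    simp only [HardSphereFlow.lawAt_eq]
    exact Measure.map_mono Measure.restrict_le_self (Φ.measurable_flow s)
  -- (0) integrability under `λ_N` from the dock's step, restricted to `S`
  obtain ⟨hYint, -⟩ := stub_windowEntropyStep σ N Φ a₀ θ₀ u₀ b ϑ wv F Yc Ym C M γ B s w hσ hσ2 ha hθ hu ha0 hθ0
    hb hϑ hwv hb0 hϑ0 hF hFC hYm hYmc hYcM hs hw hγ hB
  have hYintS : Integrable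
      (fun z => (∑ i : Fin (N + 1), w⁻¹ * ∫ r in s..(s + w), F (Φ.flow r z i)) + Yc (Φ.flow s z)) lamS :=
    hYint.mono_measure Measure.restrict_le_self
  refine ⟨hYintS, ?_⟩
  have hgood : ∀ᵐ z ∂lam, z ∈ Φ.good := ae_mem_good_localGibbsLaw σ a₀ θ₀ u₀ N Φ
  have hgoodS : ∀ᵐ z ∂lamS, z ∈ Φ.good := ae_restrict_of_ae hgood
  have hgoodψ : ∀ᵐ z ∂psi, z ∈ Φ.good := ae_mem_good_localGibbsLaw σ b ϑ wv N Φ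
  have hgood' : ∀ᵐ y ∂(Φ.lawAt lamS s), y ∈ Φ.good := by
    rw [HardSphereFlow.lawAt_eq]
    exact (ae_map_iff (Φ.measurable_flow s).aemeasurable Φ.measurableSet_good).2
      (hgoodS.mono fun z hz => Φ.mapsTo_good s hz)
  -- the window functional at the window start: raw streaming part `S0`, measurable version `St`, `Yt = St + Ym`
  set S0 : Config (N + 1) (Fin 3) T3 → ℝ := fun z =>
    ∑ i : Fin (N + 1), w⁻¹ * ∫ r in (0 : ℝ)..w, F (Φ.flow r z i) with hS0
  set St : Config (N + 1) (Fin 3) T3 → ℝ := fun z => if z ∈ Φ.good then S0 z else 0 with hSt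
  set Yt : Config (N + 1) (Fin 3) T3 → ℝ := fun z => St z + Ym z with hYt
  have hSg : Measurable fun z : Φ.good => S0 (z : Config (N + 1) (Fin 3) T3) := by
    simp only [hS0]
    exact Finset.measurable_sum _ fun i _ =>
      (measurable_intervalIntegral_comp_flow_apply Φ hF i 0 w).const_mul _
  have hStm : Measurable St := Measurable.dite hSg measurable_const Φ.measurableSet_good
  have hYtm : Measurable Yt := hStm.add hYm
  have hYt_eq : ∀ z ∈ Φ.good, Yt z = S0 z + Yc z := fun z hz => by
    simp only [hYt, hSt, if_pos hz, hYmc hz]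
  -- (1) flow property: the window functional is `Yt ∘ Φ_s` almost surely under `λ_N|_S`
  have hae : (fun z => (∑ i : Fin (N + 1), w⁻¹ * ∫ r in s..(s + w), F (Φ.flow r z i)) + Yc (Φ.flow s z))
      =ᵐ[lamS] fun z => Yt (Φ.flow s z) := by
    filter_upwards [hgoodS] with z hz
    have hz' : Φ.flow s z ∈ Φ.good := Φ.mapsTo_good s hz
    rw [hYt_eq _ hz', hS0]
    congr 1
    exact Finset.sum_congr rfl fun i _ => by rw [intervalIntegral_shift_flow Φ F i s w hz]
  -- (2) integrability of the version under the push-forward of the FULL law, then of the restricted law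
  have hC0 : 0 ≤ C := nonneg_of_abs_le_mul_one_add_sq hFC (Classical.arbitrary _)
  set g : Config (N + 1) (Fin 3) T3 → ℝ := fun z =>
    ((N + 1 : ℕ) : ℝ) * (C * (1 + ∑ j, ‖(z j).2‖ ^ 2)) + M with hg
  have hgm : Measurable g := by
    simp only [hg]
    fun_prop
  have hgi : Integrable g (Φ.lawAt lam s) := by
    rw [HardSphereFlow.lawAt_eq]
    refine (integrable_map_measure hgm.aestronglyMeasurable (Φ.measurable_flow s).aemeasurable).2 ?_
    have h1 := integrable_sum_norm_sq_flow ha hθ hu (fun x => (ha0 x).le) hθ0 σ N Φ s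
    have h2 : Integrable (fun z => ((N + 1 : ℕ) : ℝ) * (C * (1 + ∑ j, ‖(Φ.flow s z j).2‖ ^ 2)) + M) lam :=
      ((((integrable_const (1 : ℝ)).add h1).const_mul C).const_mul _).add (integrable_const M)
    exact h2
  have hgood'' : ∀ᵐ y ∂(Φ.lawAt lam s), y ∈ Φ.good :=
    EntropyClockDock.ae_mem_good_lawAt σ a₀ θ₀ u₀ N Φ s
  have hYti_full : Integrable Yt (Φ.lawAt lam s) := by
    refine hgi.mono' hYtm.aestronglyMeasurable ?_
    filter_upwards [hgood''] with z hz
    rw [hYt_eq z hz, Real.norm_eq_abs, hg, hS0]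
    exact (abs_add_le _ _).trans (add_le_add (abs_sum_windowAverage_le Φ hC0 hFC hw hz) (hYcM z hz))
  have hYti : Integrable Yt (Φ.lawAt lamS s) := hYti_full.mono_measure hmaple
  -- (3) transport: the expectation of the window functional under `λ_N|_S`
  have hint : ∫ z in S, ((∑ i : Fin (N + 1), w⁻¹ * ∫ r in s..(s + w), F (Φ.flow r z i)) + Yc (Φ.flow s z)) ∂lam =
      ∫ z, Yt z ∂(Φ.lawAt lamS s) := by
    rw [← hlamS, integral_congr_ae hae, HardSphereFlow.lawAt_eq,
      integral_map (Φ.measurable_flow s).aemeasurable hYtm.aestronglyMeasurable]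
  -- (4) finiteness of the relative entropy of the evolved RESTRICTED law
  have hfin : klDiv (Φ.lawAt lamS s) psi ≠ ⊤ :=
    stub_cappedKlDivNeTop hσ hσ2' ha hθ hu ha0 hθ0 hb hϑ hwv hb0 hϑ0 N Φ S s
  -- (5) the exponential moment of the version under `ψ_N` (carried by the good set)
  have hB' : ∫⁻ z, ENNReal.ofReal (Real.exp (γ * Yt z)) ∂psi ≤ ENNReal.ofReal (Real.exp B) := by
    refine le_of_eq_of_le (lintegral_congr_ae ?_) hB
    filter_upwards [hgoodψ] with z hz
    rw [hYt_eq z hz]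
  -- (6) the sub-probability entropy inequality; the mass of the push-forward is `λ_N(S)`
  have hEI := integral_le_inv_mul_toReal_klDiv_add_mass_mul (μ := Φ.lawAt lamS s) (ν := psi) hfin hYtm hYti hγ hB'
  have hmass : (Φ.lawAt lamS s) univ = lam S := by
    rw [HardSphereFlow.lawAt_eq, Measure.map_apply (Φ.measurable_flow s) MeasurableSet.univ, Set.preimage_univ,
      hlamS, Measure.restrict_apply_univ]
  rw [hint]
  rw [hmass] at hEI
  exact hEI

/-! ## §3 Exact truncation on the cap event -/

/-- **On a cap-type set the window functional of an observable equals that of any truncation agreeing with it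
below the cap** (pointwise, no measurability): if all speeds of the trajectory of `z` stay `≤ Mc` on `[0, t]`,
`[s, s + w] ⊆ [0, t]` and `FM = F` on `{‖v‖ ≤ Mc}`, then `Σ_i w⁻¹∫_s^{s+w} F(Φ_r z)_i dr = Σ_i w⁻¹∫_s^{s+w} FM(Φ_r z)_i dr`.
This is the sense in which the cubic energy current is truncated EXACTLY on the cap event (no Chebyshev term).
[cite: NachtergaeleYau2003, §5] -/
theorem sum_windowAverage_congr_of_speed_le {ε : ℝ} {n : ℕ} (Φ : HardSphereFlow (Torus.geometry (Fin 3)) ε n)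
    {F FM : T3 × V3 → ℝ} {Mc : ℝ} (hFM : ∀ y : T3 × V3, ‖y.2‖ ≤ Mc → FM y = F y)
    {t s w : ℝ} (hs : 0 ≤ s) (hw : 0 ≤ w) (hsw : s + w ≤ t) {z : Config n (Fin 3) T3}
    (hz : ∀ r ∈ Icc 0 t, ∀ i, ‖(Φ.flow r z i).2‖ ≤ Mc) :
    (∑ i, w⁻¹ * ∫ r in s..(s + w), F (Φ.flow r z i)) = ∑ i, w⁻¹ * ∫ r in s..(s + w), FM (Φ.flow r z i) := by
  refine Finset.sum_congr rfl fun i _ => ?_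
  congr 1
  refine intervalIntegral.integral_congr fun r hr => ?_
  rw [uIcc_of_le (by linarith)] at hr
  exact (hFM _ (hz r ⟨hs.trans hr.1, hr.2.trans hsw⟩ i)).symm

/-- **The truncated window entropy step on the cap event.** In the setting of `restricted_windowEntropyStep`, let
`S` be a `λ_N`-null-measurable set of initial data all of whose trajectories keep every speed `≤ Mc` on `[0, t]`
(e.g. the cap event intersected with the good set), `[s, s+w] ⊆ [0, t]`, and let `FM` be a continuous observable
of quadratic velocity growth agreeing with `F` on `{‖v‖ ≤ Mc}` (a truncation of `F`; `F` itself is arbitrary).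
If the REFERENCE law carries the exponential moment `∫⁻ exp(γ Y₀^{FM}) dψ_N ≤ e^B` of the TRUNCATED window
functional, then the UNTRUNCATED window functional under `λ_N|_S` is priced by the capped relative entropy:
`∫_S (Σ_i w⁻¹∫_s^{s+w} F(Φ_r z)_i dr + Yc(Φ_s z)) dλ_N ≤ γ⁻¹ (KL((Φ_s)_*(λ_N|_S) ‖ ψ_N) + λ_N(S)·B)`.
Proof: on `S` the two window functionals agree pointwise (`sum_windowAverage_congr_of_speed_le`), so the set
integrals agree (`setIntegral_congr_fun₀`), and `restricted_windowEntropyStep` applies to `FM`. The cap enters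
only through `B = B(γ, Mc)`. [cite: NachtergaeleYau2003, §5 Lemma 5.1] -/
theorem capped_windowEntropyStep_trunc (σ : ℝ) (N : ℕ)
    (Φ : HardSphereFlow (Torus.geometry (Fin 3)) (hsDiameter σ N) (N + 1))
    (a₀ θ₀ : T3 → ℝ) (u₀ : T3 → V3) (b ϑ : T3 → ℝ) (wv : T3 → V3)
    (F FM : T3 × V3 → ℝ) (Yc Ym : Config (N + 1) (Fin 3) T3 → ℝ) (C M Mc γ B t s w : ℝ)
    (S : Set (Config (N + 1) (Fin 3) T3))
    (hσ : 0 < σ) (hσ2 : σ < 1 / 2) (ha : Continuous a₀) (hθ : Continuous θ₀) (hu : Continuous u₀)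
    (ha0 : ∀ x, 0 < a₀ x) (hθ0 : ∀ x, 0 < θ₀ x)
    (hb : Continuous b) (hϑ : Continuous ϑ) (hwv : Continuous wv) (hb0 : ∀ x, 0 < b x) (hϑ0 : ∀ x, 0 < ϑ x)
    (hSnull : NullMeasurableSet S (localGibbsLaw σ a₀ u₀ θ₀ N Φ))
    (hScap : S ⊆ {z | ∀ r ∈ Icc 0 t, ∀ i, ‖(Φ.flow r z i).2‖ ≤ Mc})
    (hFMc : Continuous FM) (hFMC : ∀ y, |FM y| ≤ C * (1 + ‖y.2‖ ^ 2))
    (hFM : ∀ y : T3 × V3, ‖y.2‖ ≤ Mc → FM y = F y) (hYm : Measurable Ym)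
    (hYmc : Set.EqOn Ym Yc Φ.good) (hYcM : ∀ z ∈ Φ.good, |Yc z| ≤ M) (hs : 0 ≤ s) (hw : 0 < w) (hsw : s + w ≤ t)
    (hγ : 0 < γ)
    (hB : ∫⁻ z, ENNReal.ofReal (Real.exp (γ * ((∑ i : Fin (N + 1), w⁻¹ * ∫ r in (0 : ℝ)..w, FM (Φ.flow r z i)) + Yc z)))
        ∂(localGibbsLaw σ b wv ϑ N Φ) ≤ ENNReal.ofReal (Real.exp B)) :
    ∫ z in S, ((∑ i : Fin (N + 1), w⁻¹ * ∫ r in s..(s + w), F (Φ.flow r z i)) + Yc (Φ.flow s z))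
        ∂(localGibbsLaw σ a₀ u₀ θ₀ N Φ) ≤
      γ⁻¹ * ((klDiv (Φ.lawAt ((localGibbsLaw σ a₀ u₀ θ₀ N Φ).restrict S) s) (localGibbsLaw σ b wv ϑ N Φ)).toReal +
        (localGibbsLaw σ a₀ u₀ θ₀ N Φ S).toReal * B) := by
  have heq : EqOn (fun z => (∑ i : Fin (N + 1), w⁻¹ * ∫ r in s..(s + w), F (Φ.flow r z i)) + Yc (Φ.flow s z))
      (fun z => (∑ i : Fin (N + 1), w⁻¹ * ∫ r in s..(s + w), FM (Φ.flow r z i)) + Yc (Φ.flow s z)) S :=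
    fun z hz => by
      simp only
      rw [sum_windowAverage_congr_of_speed_le Φ hFM hs hw.le hsw (hScap hz)]
  rw [setIntegral_congr_fun₀ hSnull heq]
  exact (restricted_windowEntropyStep σ N Φ a₀ θ₀ u₀ b ϑ wv FM Yc Ym C M γ B s w S hσ hσ2 ha hθ hu ha0 hθ0
    hb hϑ hwv hb0 hϑ0 hFMc hFMC hYm hYmc hYcM hs hw hγ hB).2

end Summit.AtomisticToContinuum.HydrodynamicLimit.Theorems.CappedEulerLimit

end
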